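import Summits.BirchSwinnertonDyer.BirchSwinnertonDyer.Theorems.PrintX6EisensteinHalfFiveLeRestPairGuard
import Literature.NumberTheory.EllipticCurves.CastellaWan2024.GreenbergMainConjectureBDP
import Literature.NumberTheory.Automorphic.ShimuraCurveRibetTakahashiComponentOrders
import HarnessLib

/-!
# Crux `PrintX6.EisensteinHalfFiveLeRest` (item stmt-BirchSwinnertonDyer-21116) — line `mu_alpha` («μ = 0 kills α»)
# ideator seat bsd-idea-8 g9 (lens nearmiss), PUBLISH-ONLY (W-79: the LEAD x6-p2's record line `Lines/kim_deficit.lean` stays registered)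

REV 1.1 (docstrings only; every `def`/`theorem` byte-identical to rev 1 = commit 9ec37c099881, sha16 06e64594ad67ba34):
+ the K-CONDITIONS list in the docstring of `MultPairCaseOfParts` (critic V#99 P3) and two typing notes (V#99 P4); details
and the printed-proof reading of the (rat) input (V#99 P2) in `Lines/mu-alpha-desk.md` rev 2 §7–§9.

HONEST FRAMING. Nothing here is asserted about any curve; no item closes; BSD is proved for no curve by any of this.
Six `sorry`s, all inside `stub_*`; the composition `EisensteinHalfFiveLeRest_of` is kernel-checked and concludes the
crux BY NAME. The line is CONDITIONAL on the input pack `PublishedAcInputsX6MuAlpha` (= the cell's accepted pack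
`PublishedAcInputsX6PairGuard` ∧ ONE composite published statement still to be TYPED, `CW53RationalMuZeroBrooks`
below, ∧ the typed fact `PastenShimura2024_componentOrders`), exactly as road (I) is conditional on its pack.

THE NEAR-MISS AND ITS MEASURED DEFICIT. Road (I) (`X6.missingLowerBoundAt_rankZero_inertPair_of_facts`,
`eisensteinHalfFiveLeRestPairGuard_of_facts`) proves the crux on `HasInertPairPrimeToUnits W p`: two multiplicative
primes `ℓ₁ ≠ ℓ₂` with (ram) `p ∤ ord_{ℓ_i} Δ_min` at BOTH and the unit rider `p ∤ (ℓ₁²−1)(ℓ₂²−1)`. The hypothesis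
(ram) is used at exactly three places of the script: (1) the Ribet–Takahashi degree telescope through a (ram)
WITNESS (`RTDegree.padicValNat_delta_empty_eq_of_witness_mem`, making `ρ = deg φ / deg_S` a `p`-unit); (2) the
`S`-clause `p ∤ ord_ℓ Δ_min` of the by-name input hSh′ (= Castella–Wan 2024 Thm. 5.3, INTEGRAL clause, whose
proof needs «E[p] ramified at every ℓ ∣ N⁻» for ONE purpose: to make the Petersson-period ratio `α(f,f_B)` of
(5.5) a `p`-adic unit, via N⁻-minimality [CW24 MS p. 24 L70–80, p. 25 L1–5; Pra06 p. 912]); (3) the Tamagawa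
relation `TamagawaDescentAt` through `padicValNat_tamagawaProduct_baseChange_quadratic` (hypothesis `p ∤ ord_ℓ Δ`).

THE LEVER. (2) is not needed: CW24 (5.5) is the RATIONAL containment
`char_{Λac}(X^{rel,str}) Λ^ur[1/p] ⊂ (L^BDP · α)` (`L^BDP = (𝓛^BDP)²`, MS p. 23 L48–50) as ideals of `Λ^ur[1/p]`,
and `α(f,f_B) = ⟨f,f⟩/⟨f_B,f_B⟩ ≠ 0` lies in the coefficient FIELD `R₀[1/p] = Frac R₀` of `Λ^ur[1/p]`, so it is a
UNIT there whatever its valuation: `(L^BDP · α) = (L^BDP)`, i.e. `p^k · char ⊂ (L^BDP)` in `Λ^ur = R₀⟦T⟧`. CW's own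
last step (MS p. 25 L1–5: «since μ(L^BDP) = 0 by Theorem 2.3, it follows that (5.5) holds in Λ^ur») then runs
unchanged: `μ = 0` (CW24 Thm. 2.3 = [Bur17, Thm. B] for `N⁻ ≠ 1`, whose hypotheses are (ord) p split, (H1) N
squarefree prime to d_K, (H2) #{ℓ ∣ N⁻} even > 0, (H3) nebentype, (irr) ρ̄ abs. irreducible — arXiv:1504.02342
p. 4 L65–71, p. 3 L31–50 — NO ramification of E[p] at N⁻) says `p ∤ L^BDP` in `R₀⟦T⟧`, where `p` is PRIME
(`R₀⟦T⟧/(p) = 𝔽̄_p⟦T⟧`); hence `p^k F = L·G ⇒ p^k ∣ G`, i.e. `char ⊂ (L^BDP)` INTEGRALLY for every squarefree `N⁻`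
with an even number of prime factors — `E[p]` ramified there or not. The (ram) hypothesis of Thm. 5.3's second
clause only served «α is a p-adic unit» [Pra06 p. 912], which the ideal `(L·α) ⊂ Λ^ur[1/p]` never needed
(`stub_display`, pure commutative algebra over `(ℤ_p, R₀)`, is the typed form of this step). The value `𝓛^BDP(𝟙)² = unit · ((1−a_p+p)/p · log_ω z)²` is
Brooks/JSW Prop. 5.1.6–5.1.7 [arXiv:1512.06894 pp. 22–23], which has NO ramification hypothesis ((sqfree),
(gen-H), (good), (irr_K), a (ℤ,p)-optimal parametrisation). (1) and (3) are not needed either: the exponent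
`r = Σ_{ℓ ∣ N⁻} ord_p ord_ℓ Δ_min` enters the analytic side twice and cancels — `ord_p ρ = +r` by the
ANCHORED telescope (`EulerHalfAnchorDegree.padicValNat_delta_empty_eq_of_goodPrime_mem`, anchor `p ∤ ℓ₁ − 1`
supplied by the unit rider, cokernel clause (P618) = Papikian–Rabinoff from `PastenShimura2024_componentOrders`)
and `ord_p ∏_w c_w(E/K) = ord_p ∏_{w ∣ N⁺} c_w + r` (an inert multiplicative prime becomes SPLIT multiplicative
over the unramified quadratic `K_w`, `c_w = ord_ℓ Δ_min`; `stub_tamagawa…`), while the strict Selmer group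
`XAc … ∅` of the tree (= CW's `X^{rel,str}`, PA-10) has no local factor at inert primes in Castella's control
theorem (`thm23_anticyclotomicControl`, typed, no `N`-hypothesis). The descent engine with the shift `r`
(`stub_shiftedDescent`) is the seat engine `…anyField_ratFactor` with `ord_p ρ = r` and the exact Tamagawa count.

NET CLASS STATEMENT (beyond print as a stated theorem, conditional on the pack): the crux on
`HasMultPairPrimeToUnits W p` — two distinct multiplicative primes with the unit rider and NO (ram) condition —
(`stub_multPairCase_of_parts`), and the typed residual `¬ HasMultPairPrimeToUnits` (`stub_thinResidual`: prime
conductor, or every pair of multiplicative primes meets `p ∣ ℓ² − 1`; census: the 2 THIN-GUARD records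
246697a1@5, 321518d1@5, both already booked per pair by Kurihara C-57/C-58 — so the census value of this line is
0 records; its value is the CLASS theorem: road (I)'s sub-class `HasInertPairPrimeToUnits ⊊ HasMultPairPrimeToUnits`,
`HasInertPairPrimeToUnits.toHasMultPairPrimeToUnits` below, PROVED).

DISPROOF USED: none filed for this crux (`ledger crux ls`: no Disproof.lean) — n/a.
References: [CastellaWan2023] Thm. 2.3 (MS p. 7 L19–23), Prop. 2.1/2.7 (MS pp. 6–9), Thm. 5.3 with (5.5) (MS pp. 23–25);
[JetchevSkinnerWan2017] §5.1.2 Props. [Brooks] (arXiv:1512.06894 p. 22 L58–94, p. 23 L1–14), §7.4.1 (pp. 29–30);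
[Burungale2017] = arXiv:1504.02342, Thm. B (p. 4) with hypotheses (ord)(H1)(H2)(H3)(irr) (p. 3); [Castella2018] Thm. 2.3; [PastenShimura2024] Prop. 6.13, Lemma 6.15, Lemma 6.18;
[PapikianRabinoff2016] Cor. 3.5; [RibetTakahashi1997] Thm. 1; [CaiShuTian2014] Thm. 1.5; [Kobayashi2013] Rem. 1.3;
[SerreLocalFields1979] II §5, IV §4 (R₀ = W(𝔽̄_p), p prime in R₀).
-/

set_option autoImplicit false
set_option linter.unusedVariables false
set_option linter.dupNamespace false

noncomputable section

open scoped Classical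

open PowerSeries WeierstrassCurve NumberField IsDedekindDomain Field
  Literature.NumberTheory.EllipticCurves Literature.NumberTheory.EllipticCurves.ModularForms
  Literature.NumberTheory.EllipticCurves.Rank1Residual
  Literature.NumberTheory.EllipticCurves.Rank1Residual.Typed
  Literature.NumberTheory.EllipticCurves.Castella2018
  Literature.NumberTheory.Automorphic CongruenceSubgroup
  Summit.BirchSwinnertonDyer.Rank1Residual Summit.BirchSwinnertonDyer.Rank1Residual.Supersingular

namespace Summit.BirchSwinnertonDyer.BirchSwinnertonDyer.Cruxes.EisensteinHalfFiveLeRest.MuAlpha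

/-! ### §0 The enlarged sub-class: a multiplicative pair under the unit rider, NO (ram) condition -/

/-- **`HasMultPairPrimeToUnits W p`**: two distinct multiplicative primes `ℓ₁ ≠ ℓ₂` of `E` with the printed
unit rider `p ∤ (ℓ₁² − 1)(ℓ₂² − 1)` (Brooks/JSW constant `∏(ℓ−1)/(ℓ+1)`), and NOTHING about the ramification of
`E[p]` at `ℓ_i` — road (I)'s `HasInertPairPrimeToUnits` minus its two (ram) conjuncts. Decidable per pair.
TYPING NOTE (V#99 P4): `ℓ ^ 2 - 1` and (in `not_dvd_sub_one`) `ℓ₁ - 1` are ℕ-subtractions; for a prime `ℓ ≥ 2` they equal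
the integer values (`Nat.cast_sub`, `1 ≤ ℓ ^ 2`), exactly as in the tree's `HasInertPairPrimeToUnits`, so nothing is truncated. -/
def HasMultPairPrimeToUnits (W : WeierstrassCurve ℚ) [W.IsGloballyMinimal] (p : ℕ) : Prop :=
  ∃ ℓ₁ ℓ₂ : ℕ, ∃ _ : Fact ℓ₁.Prime, ∃ _ : Fact ℓ₂.Prime, ℓ₁ ≠ ℓ₂ ∧
    W.HasMultiplicativeReductionAtPrime ℓ₁ ∧ W.HasMultiplicativeReductionAtPrime ℓ₂ ∧
    ¬ p ∣ (ℓ₁ ^ 2 - 1) * (ℓ₂ ^ 2 - 1)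

/-- Road (I)'s guarded inert pair is a multiplicative pair under the rider (forget (ram)). PROVED. -/
theorem HasInertPairPrimeToUnits.toHasMultPairPrimeToUnits {W : WeierstrassCurve ℚ} [W.IsGloballyMinimal]
    {p : ℕ} (h : HasInertPairPrimeToUnits W p) : HasMultPairPrimeToUnits W p := by
  obtain ⟨ℓ₁, ℓ₂, i₁, i₂, hne, h₁, h₂, -, -, hu⟩ := h
  exact ⟨ℓ₁, ℓ₂, i₁, i₂, hne, h₁, h₂, hu⟩

/-- The rider splits per prime: `p ∤ ℓ₁² − 1` (hence the RT anchor `p ∤ ℓ₁ − 1`) and `p ∤ ℓ₂² − 1`. PROVED. -/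
theorem HasMultPairPrimeToUnits.not_dvd_sub_one {W : WeierstrassCurve ℚ} [W.IsGloballyMinimal] {p : ℕ}
    (h : HasMultPairPrimeToUnits W p) :
    ∃ ℓ₁ ℓ₂ : ℕ, ∃ _ : Fact ℓ₁.Prime, ∃ _ : Fact ℓ₂.Prime, ℓ₁ ≠ ℓ₂ ∧
      W.HasMultiplicativeReductionAtPrime ℓ₁ ∧ W.HasMultiplicativeReductionAtPrime ℓ₂ ∧
      ¬ p ∣ ℓ₁ - 1 ∧ ¬ p ∣ ℓ₁ ^ 2 - 1 ∧ ¬ p ∣ ℓ₂ ^ 2 - 1 := by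
  obtain ⟨ℓ₁, ℓ₂, i₁, i₂, hne, h₁, h₂, hu⟩ := h
  refine ⟨ℓ₁, ℓ₂, i₁, i₂, hne, h₁, h₂, ?_, ?_, ?_⟩
  · intro hd
    apply hu
    have : ℓ₁ ^ 2 - 1 = (ℓ₁ - 1) * (ℓ₁ + 1) := by
      rcases Nat.eq_zero_or_pos ℓ₁ with h0 | hpos
      · subst h0; simp
      · have : 1 ≤ ℓ₁ := hpos
        zify [this, Nat.one_le_pow 2 ℓ₁ hpos]
        ring
    rw [this]
    exact Dvd.dvd.mul_right (Dvd.dvd.mul_right hd _) _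
  · exact fun hd ↦ hu (Dvd.dvd.mul_right hd _)
  · exact fun hd ↦ hu (Dvd.dvd.mul_left hd _)

/-! ### §1 The by-name input still to be typed (documentation `def`, NOT a stub): CW24 Thm. 5.3 RATIONAL clause at
`N⁻ = ∏S ≠ 1` with `μ = 0` (Thm. 2.3) and Brooks' value at `𝟙` (JSW §5.1.2), Cai–Shu–Tian's GZ half kept verbatim -/

/-- **[to be typed; composite of published theorems] The Heegner point of `X_{N⁺,N⁻}` at a good supersingular
`p ≥ 5`, Λ^ur-LEVEL form.** VERBATIM the binder block, hypotheses and the (GZ) conjunct of the tree's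
`shimuraCurve_heegnerPoint_grossZagier_bdpLowerBound_goodSS_primeToUnits` (hSh′) with TWO changes: (a) the
`S`-clause LOSES `¬ p ∣ padicValInt ℓ W.minimalDiscriminantInt` (no ramification of `E[p]` at `N⁻`); (b) the
ℤ_p-display `∃ e : ℤ_p, F(0) = e · (…)²` is REPLACED by the three printed statements it came from, at the level
of `Λ^ur = R₀⟦T⟧` (`UnrSeries p`): (μ) `p ∤ 𝓛` [CW24 Thm. 2.3 = Bur17 Thm. B: `μ(𝓛_v^BDP) = 0` under «E[p]|G_K
abs. irreducible»]; (rat) `∃ k, p^k · char_{Λac}(X^{rel,str}) Λ^ur ⊂ (𝓛)` [CW24 Thm. 5.3 first clause, (5.5)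
with `α(f,f_B) ∈ ℚ^×` absorbed: `(𝓛·α) = (𝓛)` in `Λ^ur[1/p]`; the tree's `XAc … ∅` IS `X^{rel,str}` (PA-10)];
(val) `𝓛(𝟙) = u · ((1 − a_p p⁻¹ + p⁻¹) · log_ω(z)/…)²`, `u ∈ R₀ˣ` [JSW17 Prop. 5.1.7 ∘ 5.1.6 [Brooks], up to
the constant `∏_{ℓ∣N⁻}(ℓ−1)/(ℓ+1)` guarded by the rider `∀ ℓ ∈ S, p ∤ ℓ² − 1`, kept]. The general-`N⁻` shape is
the `TODO(general form)` of `CastellaWan2024/GreenbergMainConjectureBDP.lean` (there typed at `N⁻ = 1`).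
Flags inherited: CW24-53-XrelstrReading (RESOLVED PA-10), CW24-53-orientation (𝔭 vs 𝔭̄: hSh′'s `vbar`), the
identification `JSW L_p(f) = (CW 𝓛^BDP)²` up to `R₀ˣ` (R-5.2/R-5.3), Bur17 Thm. B's standing hypotheses. -/
def CW53RationalMuZeroBrooks : Prop :=
  ∀ (W : WeierstrassCurve ℚ) [W.IsElliptic] [W.IsGloballyMinimal] (p : ℕ) [Fact p.Prime]
    (N : ℕ) [NeZero N] (K : Type) [Field K] [NumberField K] (S : Finset ℕ)
    (Dt : ModularParametrizationData W N)
    (X : ShimuraCurveData (∏ q ∈ S, q) (N / ∏ q ∈ S, q))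
    (W' : WeierstrassCurve ℚ) [W'.IsElliptic] (P₀ : ShimuraParametrizationData X W'),
    W.conductorNorm ℤ = N → 5 ≤ p → GoodSS W p → Squarefree N →
    W.HasIrreducibleModPGaloisRep p → (W.baseChange K).HasIrreducibleModPGaloisRep p →
    IsImaginaryQuadratic K → Even S.card → S.Nonempty →
    (∀ ℓ ∈ S, ℓ.Prime ∧ ℓ ∣ N ∧ ¬ ℓ ^ 2 ∣ N ∧
      ((Ideal.span {(ℓ : ℤ)}).primesOver (𝓞 K)).ncard = 1 ∧ ¬ (ℓ : ℤ) ∣ NumberField.discr K) →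
    (∀ ℓ ∈ S, ¬ p ∣ ℓ ^ 2 - 1) →
    (∀ ℓ : ℕ, ℓ.Prime → ℓ ∣ N → ℓ ∉ S → ((Ideal.span {(ℓ : ℤ)}).primesOver (𝓞 K)).ncard = 2) →
    ((Ideal.span {(p : ℤ)}).primesOver (𝓞 K)).ncard = 2 →
    (Odd N → ((Ideal.span {(2 : ℤ)}).primesOver (𝓞 K)).ncard = 2) →
    P₀.IsMinimalFor W →
    ∃ (P : (W.baseChange K).toAffine.Point) (degS : ℕ), 0 < degS ∧
      padicValNat p degS = padicValNat p P₀.deg ∧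
      -- (GZ) Cai–Shu–Tian Thm. 1.5, special case 1 (verbatim hSh′)
      LDerivEK W K =
        8 * (Real.pi : ℂ) ^ 2 * peterssonProduct (Gamma0 N) 2 Dt.f Dt.f /
            ((((Units.torsionOrder K : ℝ) / 2) ^ 2 * √|(NumberField.discr K : ℝ)| : ℝ) : ℂ) *
          ((P.canonicalHeight : ℂ) / (degS : ℂ)) ∧
      -- (Λ^ur level) CW24 Thm. 2.3 (μ = 0) ∧ Thm. 5.3 rational clause (5.5) ∧ JSW §5.1.2 [Brooks] value at 𝟙
      (∀ (ι : K →+* ℚ_[p]) (v vbar : HeightOneSpectrum (𝓞 K)),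
        (∀ x : 𝓞 K, x ∈ v.asIdeal ↔ ‖ι (x : K)‖ < 1) →
        ((p : ℕ) : 𝓞 K) ∈ vbar.asIdeal → vbar ≠ v →
      ∀ (κ : ZpExtension K p), κ.IsAnticyclotomic →
      ∀ (γ : Field.absoluteGaloisGroup K) [Fact (κ.IsTopGenerator γ)],
      ∃ L : UnrSeries p,
        ¬ (C (p : unrIntegers p) ∣ L) ∧
        (∀ (j : ℤ_[p] →+* unrIntegers p),
          (∀ x : ℤ_[p], ((j x : unrIntegers p) : ℂ_[p]) = algebraMap ℚ_[p] ℂ_[p] (x : ℚ_[p])) →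
          ∃ k : ℕ, Ideal.span {C ((p : unrIntegers p) ^ k)} *
              (AcSelmer.XAc.charIdeal (W.baseChange K) p κ vbar ∅ γ).map (PowerSeries.map j) ≤
            Ideal.span {L}) ∧
        ∃ u : (unrIntegers p)ˣ,
          ((constantCoeff L : unrIntegers p) : ℂ_[p]) =
            ((u : unrIntegers p) : ℂ_[p]) *
              algebraMap ℚ_[p] ℂ_[p]
                (((1 - (W.frobeniusTrace p : ℚ_[p]) * (p : ℚ_[p])⁻¹ + (p : ℚ_[p])⁻¹) *
                    ((W.baseChange ℚ_[p]).padicLogPoint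
                        (formalIndex W p • padicPointOf W p ι P) /
                      (formalIndex W p : ℚ_[p]))) ^ 2))

/-- **The input pack of the line**: the cell's accepted pack of road (I) ∧ the Λ^ur-level composite above ∧
Pasten's component-order fact (for the cokernel clause (P618) = Papikian–Rabinoff, the RT anchor). -/
def PublishedAcInputsX6MuAlpha : Prop :=
  PublishedAcInputsX6PairGuard ∧ CW53RationalMuZeroBrooks ∧ PastenShimura2024_componentOrders

/-! ### §2 The stub statements -/

/-- **(S-display) «μ = 0 kills α» — pure commutative algebra over `(ℤ_p, R₀ = unrIntegers p)`.** If `L ∈ R₀⟦T⟧`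
is not divisible by `p`, `p^k · (F) ⊂ (L)` after base change along `j : ℤ_p → R₀`, and `L(0) = u · c` with
`u ∈ R₀ˣ`, `c ∈ ℚ_p`, then `F(0) = e · c` with `e ∈ ℤ_p`. Route: `p` is PRIME in `R₀` (IN TREE:
`prime_natCast_p_unrIntegers` in `Theorems/ErratumRoadFiveIMCDivOneSidedNoFiniteSubmoduleFree.lean`,
`isDiscreteValuationRing_unrIntegers` in `Rank1Residual/X2/HidaLimitCongruenceAlgebra.lean`) ⇒ `C p` prime in `R₀⟦T⟧`
(Gauss-content induction on the lowest coefficient not divisible by `p`, or `(R₀/p)⟦T⟧` a domain) ⇒ cancel `p^k`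
(`¬ p ∣ L`) ⇒ `j(F) = L·H` ⇒ `F(0)/c = u·H(0) ∈ R₀ ∩ ℚ_p`, norm `≤ 1` (`norm_coe_unrIntegers_le_one`), so in `ℤ_p`
(`c = 0` ⇒ `F(0) = 0`; `exists_unit_unrIntegers_mul_eq_of_norm_eq` pattern). Size S–M. [SerreLocalFields1979, II §5] -/
def DisplayOfRationalMuZero : Prop :=
  ∀ (p : ℕ) [Fact p.Prime] (j : ℤ_[p] →+* unrIntegers p),
    (∀ x : ℤ_[p], ((j x : unrIntegers p) : ℂ_[p]) = algebraMap ℚ_[p] ℂ_[p] (x : ℚ_[p])) →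
    ∀ (F : IwasawaAlgebra p) (L : UnrSeries p) (c : ℚ_[p]),
    ¬ (C (p : unrIntegers p) ∣ L) →
    (∃ k : ℕ, Ideal.span {C ((p : unrIntegers p) ^ k)} * (Ideal.span {F}).map (PowerSeries.map j) ≤
      Ideal.span {L}) →
    (∃ u : (unrIntegers p)ˣ,
      ((constantCoeff L : unrIntegers p) : ℂ_[p]) = ((u : unrIntegers p) : ℂ_[p]) * algebraMap ℚ_[p] ℂ_[p] c) →
    ∃ e : ℤ_[p], ((constantCoeff F : ℤ_[p]) : ℚ_[p]) = (e : ℚ_[p]) * c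

/-- **(S-shift) the rank-0 descent engine with a NON-UNIT degree ratio.** The seat engine
`X6.missingLowerBoundAt_rankZero_of_onTreeGoodLinksAt_anyField_ratFactor` VERBATIM with `padicValRat p ρ = 0`
replaced by `padicValRat p ρ = r` AND the exact Tamagawa count `ord_p ∏_w c_w(E/K) = ord_p ∏_{w∣N⁺} c_w + r`
(same `r`): the `+r` of `L'(E/K,1) = ρ · c_GZ · ĥ(P)` and the `−r` of the Tamagawa term cancel, the engine's
`tamagawaProductSplit_dvd_tamagawaProduct_baseChange` inequality becoming this equality. Proof = the engine's
proof replayed (JSW §7.4.1; Kobayashi 2013 Rem. 1.3 for the twist). Size M.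
TYPING NOTE (V#99 P4): `r : ℕ` and `padicValRat p ρ : ℤ`, so the binder is `padicValRat p ρ = ((r : ℕ) : ℤ)`; the same
ℕ-valued `r` (in the assembly `∑ ℓ ∈ S, padicValNat p (padicValInt ℓ W.minimalDiscriminantInt)`, `padicValInt` being ℕ-valued)
enters the Tamagawa binder below, so the `±r` cancellation is an identity of ℕ-casts. -/
def ShiftedDescent : Prop :=
  ∀ (W : WeierstrassCurve ℚ) [W.IsElliptic] [W.IsGloballyMinimal] (p : ℕ) [Fact p.Prime]
    (N : ℕ) [NeZero N] (K : Type) [Field K] [NumberField K]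
    (Dt : ModularParametrizationData W N) (P : (W.baseChange K).toAffine.Point),
    Kobayashi2013.rem13_padicValRat_bsd_rank_one_le_of_kato →
    rank_eq_analyticRank_of_analyticRank_le_one → hasEntireLFunction_rat →
    ClassX6 W p → W.analyticRank = 0 → 5 ≤ p →
    IsImaginaryQuadratic K → SatisfiesHeegnerHypothesis p K → ¬ p ∣ Units.torsionOrder K →
    (W.quadraticTwist (NumberField.discr K : ℚ)).analyticRank = 1 →
    ∀ (Wd : WeierstrassCurve ℚ) [Wd.IsElliptic] [Wd.IsGloballyMinimal] (Cd : VariableChange ℚ),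
    Cd • W.quadraticTwist (NumberField.discr K : ℚ) = Wd → ¬ (p : ℤ) ∣ Dt.c →
    ∀ (ρ : ℚ) (r : ℕ), 0 < ρ → padicValRat p ρ = r →
    LDerivEK W K = (((ρ : ℝ) * grossZagierConstant Dt K * P.canonicalHeight : ℝ) : ℂ) →
    ∀ (κ : ZpExtension K p) (𝔭 : HeightOneSpectrum (𝓞 K)) (γ : Field.absoluteGaloisGroup K)
      [Fact (κ.IsTopGenerator γ)] (ιp : K →+* ℚ_[p]),
    X11b.IMCLowerWaldspurgerOnTreeGoodAt p κ 𝔭 γ ιp P → X11b.ControlOnTreeGoodAt p κ 𝔭 γ ιp P →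
    X11b.TamagawaDescentAt W p K Wd →
    padicValNat p (W.baseChange K).tamagawaProduct = padicValNat p (X11b.tamagawaProductSplit W K) + r →
    MissingLowerBoundAt W p

/-- **(S-tamagawa) local Tate theory at INERT multiplicative primes, no (ram) condition.** For `[K:ℚ] = 2`,
`p ≥ 5`, a set `S` of multiplicative primes of `E` inert and unramified in `K`, all other bad primes split:
(a) `TamagawaDescentAt` (`ord_p ∏_w c_w(E/K) = ord_p ∏ c_ℓ(E) + ord_p ∏ c_ℓ(E^{d_K})`) and (b)
`ord_p ∏_w c_w(E/K) = ord_p ∏_{w ∣ N⁺} c_w + Σ_{ℓ ∈ S} ord_p ord_ℓ Δ_min`. WHY TRUE: at inert multiplicative `ℓ`,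
`E/K_w` is SPLIT multiplicative (the unramified quadratic twist dies in `K_w`), `c_w = ord_w Δ = ord_ℓ Δ_min`
(Kodaira–Néron, tree `kodairaNeron_localTamagawaNumber`), and exactly one of `E`, `E^{d_K}` is split at `ℓ`
(`c = n_ℓ`), the other non-split (`c ∈ {1,2}`, a `p`-unit); split and ramified primes as in the tree's
`padicValNat_tamagawaProduct_baseChange_quadratic` (which assumes `p ∤ ord_ℓ Δ` instead). Size M. -/
def TamagawaInertMult : Prop :=
  ∀ (W : WeierstrassCurve ℚ) [W.IsElliptic] [W.IsGloballyMinimal] (p : ℕ) [Fact p.Prime]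
    (K : Type) [Field K] [NumberField K] (S : Finset ℕ),
    5 ≤ p → Module.finrank ℚ K = 2 →
    (∀ ℓ ∈ S, ℓ.Prime ∧ ℓ ∣ W.conductorNorm ℤ ∧ ¬ ℓ ^ 2 ∣ W.conductorNorm ℤ ∧
      ((Ideal.span {(ℓ : ℤ)}).primesOver (𝓞 K)).ncard = 1 ∧ ¬ (ℓ : ℤ) ∣ NumberField.discr K) →
    (∀ ℓ : ℕ, ℓ.Prime → ℓ ∣ W.conductorNorm ℤ → ℓ ∉ S →
      ((Ideal.span {(ℓ : ℤ)}).primesOver (𝓞 K)).ncard = 2) →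
    ∀ (Wd : WeierstrassCurve ℚ) [Wd.IsElliptic] [Wd.IsGloballyMinimal],
    (∃ Cd : VariableChange ℚ, Cd • W.quadraticTwist (NumberField.discr K : ℚ) = Wd) →
    X11b.TamagawaDescentAt W p K Wd ∧
      padicValNat p (W.baseChange K).tamagawaProduct =
        padicValNat p (X11b.tamagawaProductSplit W K) +
          ∑ ℓ ∈ S, padicValNat p (padicValInt ℓ W.minimalDiscriminantInt)

/-- **(S-case) THE CLASS THEOREM FROM THE PARTS: the crux on `HasMultPairPrimeToUnits`** — closable OUTRIGHT from
its hypotheses (the pack + the three part statements) by road (I)'s 300-line script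
(`X6.missingLowerBoundAt_rankZero_inertPair_of_facts`) with three substitutions: the degree datum from the
ANCHOR `p ∤ ℓ₁ − 1` (`EulerHalfAnchorDegree.padicValNat_delta_empty_eq_of_goodPrime_mem` under (P618) of
`PastenShimura2024_componentOrders`), giving `ord_p ρ = r := Σ_{S} ord_p ord_ℓ Δ_min`; the link
`IMCLowerWaldspurgerOnTreeGoodAt` from `CW53RationalMuZeroBrooks` ∘ (S-display) ∘ the tree's
`imcLowerWaldspurgerOnTreeGoodAt_of_bdpDisplay_of_thm23` (a `j : ℤ_p →+* R₀` is the corestricted `algebraMap`);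
Tamagawa from (S-tamagawa); the descent from (S-shift). Friedberg–Hoffstein field, JL datum, Kato/GZK, Manin as in
road (I). Size L (assembly).
K-CONDITIONS (V#99 P3) — the auxiliary field is the output of the SAME call as road (I) l.144–145,
`hFH W hw S hSmult hSeven hSne p hgood 4` (`friedbergHoffstein_exists_twist_simpleZero_inertAt_splitAt`, `S = {ℓ₁, ℓ₂}`,
`B = 4`), and the six stubs use exactly its conjuncts and nothing else about `K`:
(K0) `IsImaginaryQuadratic K`, `4 < |d_K|` (⇒ `w_K = 2`, `¬ p ∣ Units.torsionOrder K`; `finrank ℚ K = 2`) → (S-shift), (S-tamagawa);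
(K1) each `ℓ ∈ S` inert and unramified (`ncard (primesOver ℓ) = 1`, `ℓ ∤ d_K`) → (S-tamagawa), pack S-clause [Bur17 (H2): #N⁻ = 2 even;
     CW24 5.3 (ii) = CLW22 §5.2 "some q ∣ N non-split"]; NO ramification of `E[p]` at `ℓ ∈ S` is assumed anywhere;
(K2) every `ℓ ∣ N`, `ℓ ∉ S` split (`ncard = 2`) → (S-tamagawa), pack (gen-HH; with K1 and ClassX6-semistable: Bur17 (H1));
(K3) `2 ∤ N → 2` split → pack [CW24 5.3 (iii) = CLW22 §5.2];
(K4) `SatisfiesHeegnerHypothesis p K` (p split) → (S-shift), pack [Bur17 (ord); CLW22 8.2.1 "p split"], the display's `j`;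
(K5) `L(E^{(d_K)},1) = 0`, `L'(E^{(d_K)},1) ≠ 0` (twist analytic rank 1) → (S-shift);
derived, not assumed: `E[p]` abs. irreducible over `G_K` (road (I) `irrK_of_goodSS`, l.162–163) → pack [Bur17 (irr); CLW22 §5.2,
automatic for non-ordinary p]; Bur17 (H3) vacuous for the trivial branch character. NOT required: `p ∤ h_K`.
Compatibility: K0–K4 are finitely many local quadratic prescriptions and K5 is Friedberg–Hoffstein Thm B in the odd-sign
alternative (`ε(E) = +1`, `χ_d(−N) = −1` since #S = 2); the in-tree fact delivers the conjunction and road (I) already consumes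
it with this argument list — mu-alpha adds no condition on `K` (memo `Lines/mu-alpha-desk.md` §7). -/
def MultPairCaseOfParts : Prop :=
  PublishedAcInputsX6MuAlpha → DisplayOfRationalMuZero → ShiftedDescent → TamagawaInertMult →
  ∀ (W : WeierstrassCurve ℚ) [W.IsElliptic] [W.IsGloballyMinimal] (p : ℕ) [Fact p.Prime],
    ¬ W.HasCM → 5 ≤ p → ClassX6 W p → W.analyticRank = 0 → ¬ HasErratumPrime W p →
    HasMultPairPrimeToUnits W p →
    ∀ q : ℚ, shaAn W = (q : ℂ) → padicValRat p q ≠ 0 → padicValRat p q ≤ (padicValNat p W.shaOrder : ℤ)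

/-- **(S-residual) THE TYPED RESIDUAL, BY NAME**: the crux on `¬ HasMultPairPrimeToUnits` — semistable, `r_an = 0`,
good supersingular `p ≥ 5`, no erratum prime, and EITHER a single multiplicative prime (prime conductor: no
indefinite Shimura curve, no inert pair) OR every pair of multiplicative primes has `p ∣ (ℓ₁²−1)(ℓ₂²−1)`.
Census (bsd-print-x6 ty3 p574374 + THIN-GUARD): 2 records (246697a1@5, 321518d1@5), both booked per pair by
Kurihara's criterion (C-57/C-58); no class-wide tool in print (BSTW Thm. 1.3, arXiv:2409.01350, PRE, is the only
by-name statement reaching it). This stub is the line's honest remainder, not a claim of method. Size: open. -/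
def ThinResidual : Prop :=
  ∀ (W : WeierstrassCurve ℚ) [W.IsElliptic] [W.IsGloballyMinimal] (p : ℕ) [Fact p.Prime],
    ¬ W.HasCM → 5 ≤ p → ClassX6 W p → W.analyticRank = 0 → ¬ HasErratumPrime W p →
    ¬ HasMultPairPrimeToUnits W p →
    ∀ q : ℚ, shaAn W = (q : ℂ) → padicValRat p q ≠ 0 → padicValRat p q ≤ (padicValNat p W.shaOrder : ℤ)

/-! ### §3 The registered stubs (the ONLY `sorry`s of the file) -/

/-- INPUT STUB (the pack; discharged conjunct-by-conjunct by citation / typing, never «proved»). -/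
theorem stub_pack : PublishedAcInputsX6MuAlpha := by
  sorry

/-- Stub (S-display): «μ = 0 kills α», commutative algebra over `(ℤ_p, R₀)`. -/
theorem stub_display : DisplayOfRationalMuZero := by
  sorry

/-- Stub (S-shift): the descent engine with `ord_p ρ = r` and the exact Tamagawa count. -/
theorem stub_shiftedDescent : ShiftedDescent := by
  sorry

/-- Stub (S-tamagawa): Tamagawa numbers over `K` at inert multiplicative primes, no (ram) condition. -/
theorem stub_tamagawaInertMult : TamagawaInertMult := by
  sorry

/-- Stub (S-case): the class theorem on `HasMultPairPrimeToUnits` from the pack and the parts. -/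
theorem stub_multPairCase_of_parts : MultPairCaseOfParts := by
  sorry

/-- Stub (S-residual): the typed residual `¬ HasMultPairPrimeToUnits`. -/
theorem stub_thinResidual : ThinResidual := by
  sorry

/-! ### §4 The kernel-checked composition: the stubs conclude the crux BY NAME -/

/-- **COMPOSITION.** The six stub statements imply the route decl
`Summit.BirchSwinnertonDyer.BirchSwinnertonDyer.Theses.PrintX6.EisensteinHalfFiveLeRest` (excluded middle on
`HasMultPairPrimeToUnits W p`). No `sorry`. -/
theorem EisensteinHalfFiveLeRest_of :
    PublishedAcInputsX6MuAlpha → DisplayOfRationalMuZero → ShiftedDescent → TamagawaInertMult →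
    MultPairCaseOfParts → ThinResidual →
    Summit.BirchSwinnertonDyer.BirchSwinnertonDyer.Theses.PrintX6.EisensteinHalfFiveLeRest := by
  intro hpack hdisp hshift htam hcase hres W _ _ p _ hCM hp5 hX hr hE q hq hq0
  by_cases hpair : HasMultPairPrimeToUnits W p
  · exact hcase hpack hdisp hshift htam W p hCM hp5 hX hr hE hpair q hq hq0
  · exact hres W p hCM hp5 hX hr hE hpair q hq hq0

/-- The crux from the stubs as they stand (one line; inherits the six `sorry`s — bookkeeping only). -/
theorem EisensteinHalfFiveLeRest_of_stubs :
    Summit.BirchSwinnertonDyer.BirchSwinnertonDyer.Theses.PrintX6.EisensteinHalfFiveLeRest :=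
  EisensteinHalfFiveLeRest_of stub_pack stub_display stub_shiftedDescent stub_tamagawaInertMult
    stub_multPairCase_of_parts stub_thinResidual

/-- SANITY (road (I) ⊆ this line): the guarded inert-pair class of `eisensteinHalfFiveLeRestPairGuard_of_facts` is
contained in the multiplicative-pair class of (S-case). PROVED (it is `toHasMultPairPrimeToUnits`). -/
example {W : WeierstrassCurve ℚ} [W.IsGloballyMinimal] {p : ℕ} (h : HasInertPairPrimeToUnits W p) :
    HasMultPairPrimeToUnits W p := HasInertPairPrimeToUnits.toHasMultPairPrimeToUnits h

end Summit.BirchSwinnertonDyer.BirchSwinnertonDyer.Cruxes.EisensteinHalfFiveLeRest.MuAlpha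

end
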